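import Mathlib
import Summits.CriticalPhenomena.SAWScalingLimit.Theorems.SAWRenewalTightnessConfinementPositivityBridgeTubeCosine
import HarnessLib

/-!
# Crux `ConfinementPositivity` (stmt-CriticalPhenomena-17587), line `Sketch` (sign-universality):
# the additive-functional (Markov budget) bound for tuples of pieces

Generic engine `chainMarkov_claim`, stub F3 of stub B′u (`stub_unpinnedSlabTube`) of the lead skeleton
`Cruxes/ConfinementPositivity/Lines/Sketch.lean`.

Abstract setting: a type `P` of *pieces* with a weight `ν : P → ℝ≥0∞`, a natural *span* `sp : P → ℕ` and a
nonnegative *functional* `A : P → ℝ≥0∞` (for Kesten's irreducible bridges: the squared vertical extent).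
HYPOTHESIS (conditional second moment): for every span value `s ≤ smax`,
`Σ'_{sp p = s} A p · ν p ≤ C s² · Σ'_{sp p = s} ν p`.
CONCLUSION: over `k`-tuples `f : Fin k → P` whose pieces all have span `≤ smax` and whose total span is `ℓ`,
`Σ'_f (Σᵢ A (f i)) ∏ᵢ ν (f i) ≤ C · smax · ℓ · Σ'_f ∏ᵢ ν (f i)`.

Proof: induction on `k`, peeling off the first piece (`Fin.cons`).  A first piece of span `σ ≤ smax` contributes
`≤ C σ² ≤ C smax σ` (hypothesis, after summing over the fibre `sp = σ`), the remaining `k`-tuple, of total span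
`ℓ - σ`, contributes `≤ C smax (ℓ - σ)` (induction hypothesis), and `σ + (ℓ - σ) = ℓ`.  Everything is in `ℝ≥0∞`
(no summability issues); pure algebra, nothing about SAWs.
-/

noncomputable section

open scoped BigOperators ENNReal
open Classical

namespace Summit.CriticalPhenomena.SAWScalingLimit.Theorems

namespace ChainMarkov

variable {P : Type*}

/-! ### Splitting `k+1`-tuples into the first piece and the rest

The splitting `tsum_succ_eq`, `prod_cons` and `forall_cons_iff` are reused from the landed module
`Theorems/SAWRenewalTightnessConfinementPositivityBridgeTubeCosine.lean` (namespace `BridgeTubeCosine`); its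
`sum_cons` is for `ℤ`-valued spans, here is the version for an arbitrary additive commutative monoid
(used at `ℕ` for the spans and at `ℝ≥0∞` for the functional). -/

/-- Sums along `Fin.cons` (adapted from `BridgeTubeCosine.sum_cons`, any additive commutative monoid). -/
theorem sum_cons {M : Type*} [AddCommMonoid M] (φ : P → M) {k : ℕ} (s : P) (g : Fin k → P) :
    (∑ i : Fin (k + 1), φ ((Fin.cons s g : Fin (k + 1) → P) i)) = φ s + ∑ i : Fin k, φ (g i) := by
  rw [Fin.sum_univ_succ]
  simp only [Fin.cons_zero, Fin.cons_succ]

/-! ### Summing over the fibres of the span -/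

/-- Fibrewise summation: `Σ'_s w s · G (sp s) = Σ'_σ (Σ'_{sp s = σ} w s) · G σ`. -/
theorem tsum_fiber (w : P → ℝ≥0∞) (sp : P → ℕ) (G : ℕ → ℝ≥0∞) :
    ∑' s, w s * G (sp s) = ∑' σ, (∑' s, if sp s = σ then w s else 0) * G σ := by
  symm
  calc ∑' σ, (∑' s, if sp s = σ then w s else 0) * G σ
      = ∑' σ, ∑' s, (if sp s = σ then w s else 0) * G σ :=
        tsum_congr fun σ => ENNReal.tsum_mul_right.symm
    _ = ∑' s, ∑' σ, (if sp s = σ then w s else 0) * G σ := ENNReal.tsum_comm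
    _ = ∑' s, w s * G (sp s) := by
        refine tsum_congr fun s => ?_
        rw [tsum_eq_single (sp s)]
        · rw [if_pos rfl]
        · intro σ hσ
          rw [if_neg (Ne.symm hσ), zero_mul]

/-! ### The pointwise algebra of the inductive step -/

/-- If the first piece (span `σ ≤ smax`, `σ ≤ ℓ`) has `E ≤ C σ² p` and the rest has `S ≤ C smax (ℓ - σ) M`,
then `E M + p S ≤ C smax ℓ (p M)`. -/
theorem step_pointwise (C E p M S : ℝ≥0∞) (smax ℓ σ : ℕ) (hσs : σ ≤ smax) (hσℓ : σ ≤ ℓ)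
    (hE : E ≤ C * (σ : ℝ≥0∞) ^ 2 * p) (hS : S ≤ C * smax * ((ℓ - σ : ℕ) : ℝ≥0∞) * M) :
    E * M + p * S ≤ C * smax * ℓ * (p * M) := by
  have hsq : (σ : ℝ≥0∞) ^ 2 ≤ (smax : ℝ≥0∞) * σ := by
    rw [sq]
    gcongr
  have hsum : ((σ : ℝ≥0∞) + ((ℓ - σ : ℕ) : ℝ≥0∞)) = ℓ := by
    rw [← Nat.cast_add, Nat.add_sub_of_le hσℓ]
  calc E * M + p * S
      ≤ C * (σ : ℝ≥0∞) ^ 2 * p * M + p * (C * smax * ((ℓ - σ : ℕ) : ℝ≥0∞) * M) := by gcongr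
    _ ≤ C * ((smax : ℝ≥0∞) * σ) * p * M + p * (C * smax * ((ℓ - σ : ℕ) : ℝ≥0∞) * M) := by gcongr
    _ = C * smax * ((σ : ℝ≥0∞) + ((ℓ - σ : ℕ) : ℝ≥0∞)) * (p * M) := by ring
    _ = C * smax * ℓ * (p * M) := by rw [hsum]

end ChainMarkov

open ChainMarkov in
/-- **Additive-functional (Markov budget) bound for tuples of pieces.**  Pieces `P` with weights `ν`, spans
`sp : P → ℕ` and a nonnegative functional `A`; if for every span value `s ≤ smax` the `A`-weighted mass of the
span-`s` pieces is at most `C s²` times their mass, then for every `k` and `ℓ` the `(Σᵢ A (f i))`-weighted mass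
of the `k`-tuples of pieces with all spans `≤ smax` and total span `ℓ` is at most `C · smax · ℓ` times their
mass. -/
theorem chainMarkov_claim : ∀ {P : Type} (ν : P → ℝ≥0∞) (A : P → ℝ≥0∞) (sp : P → ℕ) (C : ℝ≥0∞) (smax : ℕ),
    (∀ s : ℕ, s ≤ smax → (∑' p : P, if sp p = s then A p * ν p else 0) ≤
      C * (s : ℝ≥0∞) ^ 2 * ∑' p : P, if sp p = s then ν p else 0) →
    ∀ (k ℓ : ℕ),
      (∑' f : Fin k → P, if ((∑ i, sp (f i)) = ℓ ∧ ∀ i, sp (f i) ≤ smax) then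
          (∑ i, A (f i)) * ∏ i, ν (f i) else 0) ≤
        C * smax * ℓ * ∑' f : Fin k → P, if ((∑ i, sp (f i)) = ℓ ∧ ∀ i, sp (f i) ≤ smax) then
          ∏ i, ν (f i) else 0 := by
  intro P ν A sp C smax hyp k
  induction k with
  | zero =>
    intro ℓ
    have h0 : ∀ f : Fin 0 → P, (if ((∑ i, sp (f i)) = ℓ ∧ ∀ i, sp (f i) ≤ smax) then
        (∑ i, A (f i)) * ∏ i, ν (f i) else 0) = 0 := fun f => by simp
    rw [ENNReal.tsum_eq_zero.2 h0]
    exact zero_le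
  | succ k ih =>
    intro ℓ
    -- the level-`k` masses of the rest, as functions of the span `σ` of the first piece
    set M : ℕ → ℝ≥0∞ := fun σ => ∑' g : Fin k → P,
      if (σ + ∑ i, sp (g i) = ℓ ∧ (σ ≤ smax ∧ ∀ i, sp (g i) ≤ smax)) then ∏ i, ν (g i) else 0 with hM
    set S : ℕ → ℝ≥0∞ := fun σ => ∑' g : Fin k → P,
      if (σ + ∑ i, sp (g i) = ℓ ∧ (σ ≤ smax ∧ ∀ i, sp (g i) ≤ smax)) then
        (∑ i, A (g i)) * ∏ i, ν (g i) else 0 with hS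
    -- first-piece decomposition of the two sides
    have hL : (∑' f : Fin (k + 1) → P, if ((∑ i, sp (f i)) = ℓ ∧ ∀ i, sp (f i) ≤ smax) then
        (∑ i, A (f i)) * ∏ i, ν (f i) else 0) = ∑' s, (A s * ν s * M (sp s) + ν s * S (sp s)) := by
      rw [BridgeTubeCosine.tsum_succ_eq]
      refine tsum_congr fun s => ?_
      rw [hM, hS]
      dsimp only
      rw [← ENNReal.tsum_mul_left, ← ENNReal.tsum_mul_left, ← ENNReal.tsum_add]
      refine tsum_congr fun g => ?_
      simp only [sum_cons sp s g, sum_cons A s g, BridgeTubeCosine.prod_cons ν s g,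
        BridgeTubeCosine.forall_cons_iff (fun q => sp q ≤ smax) s g]
      split_ifs <;> ring
    have hR : (∑' f : Fin (k + 1) → P, if ((∑ i, sp (f i)) = ℓ ∧ ∀ i, sp (f i) ≤ smax) then
        ∏ i, ν (f i) else 0) = ∑' s, ν s * M (sp s) := by
      rw [BridgeTubeCosine.tsum_succ_eq]
      refine tsum_congr fun s => ?_
      rw [hM]
      dsimp only
      rw [← ENNReal.tsum_mul_left]
      refine tsum_congr fun g => ?_
      simp only [sum_cons sp s g, BridgeTubeCosine.prod_cons ν s g,
        BridgeTubeCosine.forall_cons_iff (fun q => sp q ≤ smax) s g]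
      split_ifs <;> ring
    have h1 : ∑' s, A s * ν s * M (sp s) = ∑' σ, (∑' s, if sp s = σ then A s * ν s else 0) * M σ :=
      tsum_fiber (fun s => A s * ν s) sp M
    have h2 : ∑' s, ν s * S (sp s) = ∑' σ, (∑' s, if sp s = σ then ν s else 0) * S σ :=
      tsum_fiber ν sp S
    have h3 : ∑' s, ν s * M (sp s) = ∑' σ, (∑' s, if sp s = σ then ν s else 0) * M σ :=
      tsum_fiber ν sp M
    rw [hL, hR, ENNReal.tsum_add, h1, h2, h3, ← ENNReal.tsum_add, ← ENNReal.tsum_mul_left]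
    refine ENNReal.tsum_le_tsum fun σ => ?_
    by_cases hσ : σ ≤ smax ∧ σ ≤ ℓ
    · obtain ⟨hσs, hσℓ⟩ := hσ
      -- on the rest, the condition is the level-`k` condition at total span `ℓ - σ`
      have hcond : ∀ g : Fin k → P, (σ + ∑ i, sp (g i) = ℓ ∧ (σ ≤ smax ∧ ∀ i, sp (g i) ≤ smax)) ↔
          ((∑ i, sp (g i)) = ℓ - σ ∧ ∀ i, sp (g i) ≤ smax) := fun g =>
        ⟨fun ⟨h1, _, h2⟩ => ⟨by omega, h2⟩, fun ⟨h1, h2⟩ => ⟨by omega, hσs, h2⟩⟩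
      have hS' : S σ = ∑' g : Fin k → P, if ((∑ i, sp (g i)) = ℓ - σ ∧ ∀ i, sp (g i) ≤ smax) then
          (∑ i, A (g i)) * ∏ i, ν (g i) else 0 := tsum_congr fun g => if_congr (hcond g) rfl rfl
      have hM' : M σ = ∑' g : Fin k → P, if ((∑ i, sp (g i)) = ℓ - σ ∧ ∀ i, sp (g i) ≤ smax) then
          ∏ i, ν (g i) else 0 := tsum_congr fun g => if_congr (hcond g) rfl rfl
      have hIH : S σ ≤ C * smax * ((ℓ - σ : ℕ) : ℝ≥0∞) * M σ := by
        rw [hS', hM']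
        exact ih (ℓ - σ)
      exact step_pointwise C _ _ (M σ) (S σ) smax ℓ σ hσs hσℓ (hyp σ hσs) hIH
    · -- off the support: both level-`k` masses vanish
      have hc : ∀ g : Fin k → P, ¬ (σ + ∑ i, sp (g i) = ℓ ∧ (σ ≤ smax ∧ ∀ i, sp (g i) ≤ smax)) := by
        rintro g ⟨h1, h2, -⟩
        exact hσ ⟨h2, by omega⟩
      have hM0 : M σ = 0 := ENNReal.tsum_eq_zero.2 fun g => if_neg (hc g)
      have hS0 : S σ = 0 := ENNReal.tsum_eq_zero.2 fun g => if_neg (hc g)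
      rw [hM0, hS0]
      simp

end Summit.CriticalPhenomena.SAWScalingLimit.Theorems
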